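import Summits.QuantumFields.BalabanUV.T4Continuum.Support.B13ReadingsAvgTowerUniform
import Summits.QuantumFields.BalabanUV.T4Continuum.Support.B13ReadingsAvgTowerSecond

/-!
# B13ReadingsAvgTowerSecondUniform — row NE5, junction J-avg-reg SECOND ORDER (R60), abstract half, file 3: THE SECOND-ORDER
# FACTORISATION INDUCTION RUN TO THE END — letter (ℓ2) `hlipD` of `NE2FromNE3BavgBridge.localRate_regClass_of_bavg_consistent`,
# k-UNIFORM, for an averaging tower `R` with straight tower `S`: from the first-order data `FactorisationData` (file
# `B13ReadingsAvgTowerUniform`) and TWO displayed second-order letters — the finest mixed-second-difference letter `β″` of `S` and the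
# correction-SHIFT letter `κ₁` (`SecondOrderLetters`) — under the smallness `α′ ≤ 1∕16`, `κ ≤ 1∕64`, `2 ≤ L`

Cell `pub-balaban`, unit `b2b-balaban-t4-ne5-p1` (row NE5 OWNER, gen 40; owner item «g40-σ», INTENT `HOME/CLAIMS.log` l.25382; T4-DAG Q52;
RULING R60; GAPS § G-ne5p1-Javg-reg UPDATE 1).  Summits-side NEW WORK under the LEAN PLACEMENT RULE: [folklore] bookkeeping on the ABSTRACT
towers of rows NE2 ∕ B5; ONE `Prop`-valued HYPOTHESIS STRUCTURE `SecondOrderLetters` ([shape], like `FactorisationData`: it NAMES the two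
displayed second-order letters and asserts nothing), 0 other `def`, nothing printed asserted, no citation tag.  HONEST FRAMING: rung (B)+1 of
the FINITE-VOLUME T⁴ programme — NOT infinite volume, NOT a mass gap, NOT the Clay problem, NOT a proof of NE5 (NOT PRINTED; GAPS G-t4-U3-1),
NOT a proof of NE2.  The INSTANCES of the letters on Bałaban's (0.4) objects — `β″` = a (3.36)-shape finest window letter (substrate W-28a
`SubstrateSecondOrderWindow.fin_second_clause`, whose conclusion `fin_second` copies token for token), `κ₁` = a «Stokes for differences»
estimate on the one-step correction factors (NE5 swarm σ-road, dist1-quotient currency, converted by the substrate junction) — are NOT made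
here.  HONEST DEPENDENCY (cell, verbatim): continuum YM on T⁴ ⇐ BetaPertH ∧ nine spine estimates (0/9 proved); BetaPertH ⇐ (D1) ∧ (D4) ∧
CAP+tail; G-an2-4 gates asym, D1 and NE2/3/4.

THE INDUCTION (downward from the finest level `Kf`; one-step lemmas = `B13ReadingsAvgTowerSecond`; first-order uniform letters =
`B13ReadingsAvgTowerUniform`: straight sizes `≤ 2α′`, straight Lipschitz `2β′`, distance `8κ`, `RegularTransporters R (2α′+8κ) (2β′+16κ)`):
* straight mixed second differences, invariant `b″_k ≤ e^{4α′D_k}·(β″ + 16β′²·D_k)`, `D_k = 1∕ℓ_k − 1∕ℓ_Kf` (`straight_second_invariant`;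
  step `b″_k ≤ e^{2α′∕ℓ_k}(b″_{k+1} + 8β′²∕ℓ_k)`, closed by `L ≥ 2`) ⟹ `b″_k ≤ 2(β″ + 16β′²)` at EVERY level (`straight_second_uniform`,
  `α′ ≤ 1∕8`: `e^{1∕2} ≤ 1.75`);
* distance SHIFT `‖Δ_ν(R − S)‖ ≤ ρ₁,k∕ℓ_k³`, constant invariant `ρ₁,k ≤ 4(κ₁ + 9κβ₁)`, `β₁ = 2β′ + 16κ` (`dist_shift_uniform`; step
  `ρ₁,k ≤ e^{1∕4}(κ₁ + 9κβ₁ + ρ₁,k+1∕2)` and `e^{1∕4} ≤ 4∕3`);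
* END `hlipD_of_factorisation`: `‖dconnTower R k μ (i + e_ν) − dconnTower R k μ i‖ ≤ βD∕lev L k` at EVERY level with
  **`βD = 2(β″ + 16β′²) + 8(κ₁ + 9κ(2β′ + 16κ))`** — NE2's `hlipD` binder (ℓ2) token for token; `hlipD_straight`: the straight tower itself
  with `2(β″ + 16β′²)`.
The numeric thresholds are one admissible choice, not optimal.  (ℓ4) `hbavgD` (derivative-tower block-average consistency) is the next file.
0 sorry; axioms ⊆ {propext, Classical.choice, Quot.sound}.
-/

noncomputable section

open scoped BigOperators Matrix Matrix.Norms.L2Operator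

namespace Summit.QuantumFields.BalabanUV.T4Continuum.B13ReadingsAvgTowerSecondUniform

open Literature.MathematicalPhysics.QuantumFieldTheory.Balaban1983to89.B5Prop11Plancherel (fine Tor unitVec)
open Literature.MathematicalPhysics.QuantumFieldTheory.Balaban1983to89.B5Block118 (tstep)
open Literature.MathematicalPhysics.QuantumFieldTheory.Balaban1983to89.B5G183RateUnitTower (lev lev_neZero)
open Summit.QuantumFields.BalabanUV.T4Continuum.BalabanAveragedTowerUnit (idx one_le_lev' cast_lev' lev_succ')
open Summit.QuantumFields.BalabanUV.T4Continuum.BlockPairingGeometry (tau)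
open Summit.QuantumFields.BalabanUV.T4Continuum.RegularBackgroundTower (RegularTransporters connTower dconnTower)
open Summit.QuantumFields.BalabanUV.T4Continuum.B13ReadingsLineProducts (lprod)
open Summit.QuantumFields.BalabanUV.T4Continuum.B13ReadingsAvgTowerDirect (norm_R_tau_sub_le)
open Summit.QuantumFields.BalabanUV.T4Continuum.B13ReadingsAvgTowerUniform (FactorisationData cast_lev_mono inv_lev_succ
  straight_size_uniform dist_uniform regularTransporters_of_factorisation regularTransporters_straight)
open Summit.QuantumFields.BalabanUV.T4Continuum.B13ReadingsAvgTowerSecond (straight_second_of_step hlipD_of_second_letters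
  dist_shift_of_step)

variable {d : ℕ} (L : ℕ) [NeZero L] (M : Fin d → ℕ) [hM : ∀ μ, NeZero (M μ)]
variable {o : Type*} [Fintype o] [DecidableEq o]

/-! ## §1 A scalar fact -/

/-- [folklore] `e^x ≤ 4∕3` for `0 ≤ x ≤ 1∕4` (from `|e^x − 1 − x| ≤ x²` on `|x| ≤ 1`; the generic `e^x ≤ 1 + x + x²` is the tree's
`Literature.Barriers.ValiantsHypothesis.exp_le_quadratic`, not imported into this cone). -/
theorem exp_le_four_thirds {x : ℝ} (hx0 : 0 ≤ x) (hx1 : x ≤ 1 / 4) : Real.exp x ≤ 4 / 3 := by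
  have h' := (le_abs_self _).trans (Real.abs_exp_sub_one_sub_id_le (x := x)
    (by rw [abs_of_nonneg hx0]; exact hx1.trans (by norm_num)))
  nlinarith

/-! ## §2 The two displayed second-order letters, the invariants, the uniform bounds and the END -/

section Induction

variable {R S : (k : ℕ) → Fin d → (idx L M k → Matrix o o ℂ)}
variable {st : (k : ℕ) → Fin d → idx L M k → Tor (fine (L * lev L k) M)} {Cf : (k : ℕ) → Fin d → idx L M k → Matrix o o ℂ}
variable {Kf : ℕ} {α' β' κ β'' κ₁ : ℝ}

/-- [folklore] [shape] The two DISPLAYED SECOND-ORDER LETTERS of the factorisation induction (a `Prop`-valued HYPOTHESIS STRUCTURE on OUR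
abstract towers, companion of `B13ReadingsAvgTowerUniform.FactorisationData`; bookkeeping, no printed statement, nothing asserted):
* `fin_second` — at and above the finest level `Kf`, the straight tower's MIXED SECOND DIFFERENCES in the `ℓ•(ℓ•·)` currency:
  `‖ℓ•(ℓ•(S_μ(τ_ρ τ_ν i₀) − S_μ(τ_ν i₀) − S_μ(τ_ρ i₀) + S_μ(i₀)))‖ ≤ β″∕ℓ`, `ℓ = lev L k` — TOKEN FOR TOKEN the conclusion of substrate
  W-28a `SubstrateSecondOrderWindow.fin_second_clause` (junction J-σ; for Bałaban: a (3.36)-shape finest window letter);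
* `corr_shift` — below `Kf`, the one-step correction factors' LATTICE SHIFTS `‖Cf k μ (τ_ν i) − Cf k μ i‖ ≤ κ₁∕(lev L k)³` (the `hCC`
  letter of `B13ReadingsAvgTowerSecond.dist_shift_of_step`; for Bałaban: a «Stokes for differences» estimate, NE5 swarm σ-road). -/
structure SecondOrderLetters (L : ℕ) [NeZero L] (M : Fin d → ℕ) (S : (k : ℕ) → Fin d → (idx L M k → Matrix o o ℂ))
    (Cf : (k : ℕ) → Fin d → idx L M k → Matrix o o ℂ) (Kf : ℕ) (β'' κ₁ : ℝ) : Prop where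
  /-- finest mixed-second-difference letter `β″` (scaled twice), at and above `Kf` -/
  fin_second : ∀ k, Kf ≤ k → ∀ (μ ν ρ : Fin d) (i₀ : idx L M k),
    ‖((lev L k : ℕ) : ℂ) • (((lev L k : ℕ) : ℂ) •
        (S k μ (tau (fine (lev L k) M) ρ (tau (fine (lev L k) M) ν i₀)) - S k μ (tau (fine (lev L k) M) ν i₀)
          - S k μ (tau (fine (lev L k) M) ρ i₀) + S k μ i₀))‖ ≤ β'' / (lev L k : ℕ)
  /-- the correction-shift letter `‖Cf k μ (τ_ν i) − Cf k μ i‖ ≤ κ₁∕(lev L k)³` below the finest level -/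
  corr_shift : ∀ k, k < Kf → ∀ (μ ν : Fin d) (i : idx L M k),
    ‖Cf k μ (tau (fine (lev L k) M) ν i) - Cf k μ i‖ ≤ κ₁ / ((lev L k : ℕ) : ℝ) ^ 3

variable (hD : FactorisationData L M R S st Cf Kf α' β' κ) (h2 : SecondOrderLetters L M S Cf Kf β'' κ₁)

section Finest

include h2

omit hM in
/-- [folklore] the finest letter in the PLAIN currency: `‖S_μ(τ_ρ τ_ν i) − S_μ(τ_ν i) − S_μ(τ_ρ i) + S_μ(i)‖ ≤ β″∕ℓ³` at every `k ≥ Kf`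
(definitionally the `(x + e_ν + e_ρ, c)` form of `B13ReadingsAvgTowerSecond`). -/
theorem fin_second_plain {k : ℕ} (hk : Kf ≤ k) (μ ν ρ : Fin d) (i : idx L M k) :
    ‖S k μ (tau (fine (lev L k) M) ρ (tau (fine (lev L k) M) ν i)) - S k μ (tau (fine (lev L k) M) ν i)
        - S k μ (tau (fine (lev L k) M) ρ i) + S k μ i‖ ≤ β'' / ((lev L k : ℕ) : ℝ) ^ 3 := by
  have hℓ : (0 : ℝ) < (lev L k : ℕ) := by exact_mod_cast one_le_lev' L k
  have h := h2.fin_second k hk μ ν ρ i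
  rw [norm_smul, norm_smul, Complex.norm_natCast, ← mul_assoc, le_div_iff₀ hℓ] at h
  rw [le_div_iff₀ (pow_pos hℓ 3)]
  calc ‖S k μ (tau (fine (lev L k) M) ρ (tau (fine (lev L k) M) ν i)) - S k μ (tau (fine (lev L k) M) ν i)
          - S k μ (tau (fine (lev L k) M) ρ i) + S k μ i‖ * ((lev L k : ℕ) : ℝ) ^ 3
      = ((lev L k : ℕ) : ℝ) * (lev L k : ℕ) * ‖S k μ (tau (fine (lev L k) M) ρ (tau (fine (lev L k) M) ν i))
          - S k μ (tau (fine (lev L k) M) ν i) - S k μ (tau (fine (lev L k) M) ρ i) + S k μ i‖ * (lev L k : ℕ) := by ring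
    _ ≤ β'' := h

end Finest

include hD h2

omit hM in
/-- [folklore] **STRAIGHT MIXED SECOND DIFFERENCES, LEVEL-DEPENDENT INVARIANT** for `k ≤ Kf`:
`b″_k ≤ e^{4α′D_k}·(β″ + 16β′²D_k)`, `D_k = 1∕ℓ_k − 1∕ℓ_Kf` (`α′ ≤ 1∕8`, `2 ≤ L`; step `B13ReadingsAvgTowerSecond.straight_second_of_step`
fed by the k-uniform straight size `2α′` and Lipschitz `2β′` of `B13ReadingsAvgTowerUniform`). -/
theorem straight_second_invariant (hL : 2 ≤ L) (hα0 : 0 ≤ α') (hα : α' ≤ 1 / 8) (hβ0 : 0 ≤ β') (hβ''0 : 0 ≤ β'') :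
    ∀ m k, k + m = Kf → ∀ (μ ν ρ : Fin d) (i : idx L M k),
      ‖S k μ (tau (fine (lev L k) M) ρ (tau (fine (lev L k) M) ν i)) - S k μ (tau (fine (lev L k) M) ν i)
          - S k μ (tau (fine (lev L k) M) ρ i) + S k μ i‖
        ≤ Real.exp (4 * α' * ((((lev L k : ℕ) : ℝ))⁻¹ - (((lev L Kf : ℕ) : ℝ))⁻¹))
            * (β'' + 16 * β' ^ 2 * ((((lev L k : ℕ) : ℝ))⁻¹ - (((lev L Kf : ℕ) : ℝ))⁻¹)) / ((lev L k : ℕ) : ℝ) ^ 3 := by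
  have hL1 : 1 ≤ L := le_trans (by norm_num) hL
  have hLr : (2 : ℝ) ≤ L := by exact_mod_cast hL
  intro m
  induction m with
  | zero =>
    intro k hk μ ν ρ i
    rw [add_zero] at hk; subst hk
    rw [sub_self, mul_zero, Real.exp_zero, one_mul, mul_zero, add_zero]
    exact fin_second_plain L M h2 le_rfl μ ν ρ i
  | succ m ih =>
    intro k hk μ ν ρ i
    have hkK : k < Kf := by omega
    have hℓ1 : (1 : ℝ) ≤ (lev L k : ℕ) := by exact_mod_cast one_le_lev' L k
    have hℓ0 : (0 : ℝ) < (lev L k : ℕ) := by linarith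
    have hℓ0' : (0 : ℝ) < (lev L (k + 1) : ℕ) := by exact_mod_cast one_le_lev' L (k + 1)
    have hℓK : ((lev L (k + 1) : ℕ) : ℝ) ≤ (lev L Kf : ℕ) := cast_lev_mono L hL1 (by omega)
    set D' := (((lev L (k + 1) : ℕ) : ℝ))⁻¹ - (((lev L Kf : ℕ) : ℝ))⁻¹ with hD'
    set Dk := (((lev L k : ℕ) : ℝ))⁻¹ - (((lev L Kf : ℕ) : ℝ))⁻¹ with hDk
    set b' := Real.exp (4 * α' * D') * (β'' + 16 * β' ^ 2 * D') with hb'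
    have hD'0 : 0 ≤ D' := sub_nonneg.2 (inv_anti₀ hℓ0' hℓK)
    -- level-(k+1) letters of the straight tower: size `2α′` (scaled), plain Lipschitz `2β′∕ℓ′²`, mixed second differences `b′∕ℓ′³`
    have hSsize : ∀ y : Tor (fine (L * lev L k) M) × Fin d, ‖((L * lev L k : ℕ) : ℂ) • (S (k + 1) μ y - 1)‖ ≤ 2 * α' :=
      fun y => straight_size_uniform L M hD hL hα0 hα (k + 1) μ y
    have hSlip : ∀ (ν₁ : Fin d) (y : Tor (fine (L * lev L k) M) × Fin d),
        ‖S (k + 1) μ (tau (fine (L * lev L k) M) ν₁ y) - S (k + 1) μ y‖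
          ≤ 2 * β' / ((L * lev L k : ℕ) : ℝ) / ((L * lev L k : ℕ) : ℝ) :=
      fun ν₁ y => norm_R_tau_sub_le L M (regularTransporters_straight L M hD hL hα0 hα hβ0) k μ ν₁ y
    have hS2 : ∀ (ν₁ ν₂ : Fin d) (x : Tor (fine (L * lev L k) M)) (c : Fin d),
        ‖S (k + 1) μ (x + unitVec _ ν₁ + unitVec _ ν₂, c) - S (k + 1) μ (x + unitVec _ ν₁, c) - S (k + 1) μ (x + unitVec _ ν₂, c)
          + S (k + 1) μ (x, c)‖ ≤ b' / ((L * lev L k : ℕ) : ℝ) ^ 3 :=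
      fun ν₁ ν₂ x c => ih (k + 1) (by omega) μ ν₁ ν₂ (x, c)
    -- the straight structure at the four coarse indices
    have hS00 := hD.straight k hkK μ i
    have hS10 : S k μ (tau (fine (lev L k) M) ν i) = lprod (fun t => S (k + 1) μ
        (st k μ i + tstep (fine (L * lev L k) M) ν L + tstep (fine (L * lev L k) M) μ t, i.2)) L := by
      have h := hD.straight k hkK μ (tau (fine (lev L k) M) ν i); rw [hD.start_shift] at h; exact h
    have hS01 : S k μ (tau (fine (lev L k) M) ρ i) = lprod (fun t => S (k + 1) μ
        (st k μ i + tstep (fine (L * lev L k) M) ρ L + tstep (fine (L * lev L k) M) μ t, i.2)) L := by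
      have h := hD.straight k hkK μ (tau (fine (lev L k) M) ρ i); rw [hD.start_shift] at h; exact h
    have hS11 : S k μ (tau (fine (lev L k) M) ν (tau (fine (lev L k) M) ρ i)) = lprod (fun t => S (k + 1) μ
        (st k μ i + tstep (fine (L * lev L k) M) ν L + tstep (fine (L * lev L k) M) ρ L + tstep (fine (L * lev L k) M) μ t, i.2)) L := by
      have h := hD.straight k hkK μ (tau (fine (lev L k) M) ν (tau (fine (lev L k) M) ρ i))
      rw [hD.start_shift, hD.start_shift, add_right_comm (st k μ i) (tstep (fine (L * lev L k) M) ρ L) (tstep (fine (L * lev L k) M) ν L)] at h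
      exact h
    have hstep := straight_second_of_step L M (k := k) (μ := μ) (ν := ν) (ν' := ρ) (i := i) hSsize hSlip hS2 hS00 hS10 hS01 hS11
    have e : tau (fine (lev L k) M) ρ (tau (fine (lev L k) M) ν i) = tau (fine (lev L k) M) ν (tau (fine (lev L k) M) ρ i) :=
      Prod.ext (add_right_comm _ _ _) rfl
    rw [e]
    refine hstep.trans (div_le_div_of_nonneg_right ?_ (by positivity))
    -- arithmetic: `e^{2α′∕ℓ}(b′ + 8β′²∕ℓ) ≤ e^{4α′D_k}(β″ + 16β′²D_k)` from `1∕ℓ_{k+1} ≤ 1∕(2ℓ_k)`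
    have hinv : (((lev L (k + 1) : ℕ) : ℝ))⁻¹ ≤ (1 / 2) * (((lev L k : ℕ) : ℝ))⁻¹ := by
      rw [inv_lev_succ]
      exact mul_le_mul_of_nonneg_right (by rw [one_div]; exact inv_anti₀ (by norm_num) hLr) (by positivity)
    have hDD : D' + (1 / 2) * (((lev L k : ℕ) : ℝ))⁻¹ ≤ Dk := by rw [hD', hDk]; linarith
    have hE1 : 1 ≤ Real.exp (4 * α' * D') := Real.one_le_exp (by positivity)
    have h8 : 0 ≤ 8 * β' ^ 2 / ((lev L k : ℕ) : ℝ) := by positivity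
    have hsum0 : 0 ≤ β'' + 16 * β' ^ 2 * D' + 8 * β' ^ 2 / ((lev L k : ℕ) : ℝ) := by positivity
    have hexp : Real.exp (2 * α' / (lev L k : ℕ)) * Real.exp (4 * α' * D') ≤ Real.exp (4 * α' * Dk) := by
      rw [← Real.exp_add, div_eq_mul_inv]
      refine Real.exp_le_exp.2 ?_
      nlinarith [hDD, hα0, inv_nonneg.2 hℓ0.le]
    have hlin : β'' + 16 * β' ^ 2 * D' + 8 * β' ^ 2 / ((lev L k : ℕ) : ℝ) ≤ β'' + 16 * β' ^ 2 * Dk := by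
      rw [div_eq_mul_inv]; nlinarith [hDD, sq_nonneg β']
    calc Real.exp (2 * α' / (lev L k : ℕ)) * (b' + 2 * (2 * β') ^ 2 / (lev L k : ℕ))
        = Real.exp (2 * α' / (lev L k : ℕ)) * (b' + 8 * β' ^ 2 / (lev L k : ℕ)) := by ring
      _ ≤ Real.exp (2 * α' / (lev L k : ℕ)) * (b' + Real.exp (4 * α' * D') * (8 * β' ^ 2 / (lev L k : ℕ))) :=
          mul_le_mul_of_nonneg_left (add_le_add le_rfl (le_mul_of_one_le_left h8 hE1)) (Real.exp_pos _).le
      _ = (Real.exp (2 * α' / (lev L k : ℕ)) * Real.exp (4 * α' * D')) * (β'' + 16 * β' ^ 2 * D' + 8 * β' ^ 2 / (lev L k : ℕ)) := by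
          rw [hb']; ring
      _ ≤ Real.exp (4 * α' * Dk) * (β'' + 16 * β' ^ 2 * Dk) := mul_le_mul hexp hlin hsum0 (Real.exp_pos _).le

omit hM in
/-- [folklore] **STRAIGHT MIXED SECOND DIFFERENCES, UNIFORM**: `‖S_μ(τ_ρ τ_ν i) − S_μ(τ_ν i) − S_μ(τ_ρ i) + S_μ(i)‖ ≤ 2(β″ + 16β′²)∕ℓ_k³`
at EVERY level (`α′ ≤ 1∕8`, `2 ≤ L`; `e^{4α′D} ≤ 1.75 ≤ 2`). -/
theorem straight_second_uniform (hL : 2 ≤ L) (hα0 : 0 ≤ α') (hα : α' ≤ 1 / 8) (hβ0 : 0 ≤ β') (hβ''0 : 0 ≤ β'')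
    (k : ℕ) (μ ν ρ : Fin d) (i : idx L M k) :
    ‖S k μ (tau (fine (lev L k) M) ρ (tau (fine (lev L k) M) ν i)) - S k μ (tau (fine (lev L k) M) ν i)
        - S k μ (tau (fine (lev L k) M) ρ i) + S k μ i‖ ≤ 2 * (β'' + 16 * β' ^ 2) / ((lev L k : ℕ) : ℝ) ^ 3 := by
  have hℓ1 : (1 : ℝ) ≤ (lev L k : ℕ) := by exact_mod_cast one_le_lev' L k
  have hℓ0 : (0 : ℝ) < (lev L k : ℕ) := by linarith
  rcases le_or_gt Kf k with hk | hk
  · have hnum : β'' ≤ 2 * (β'' + 16 * β' ^ 2) := by nlinarith [sq_nonneg β']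
    exact (fin_second_plain L M h2 hk μ ν ρ i).trans (div_le_div_of_nonneg_right hnum (by positivity))
  · have h := straight_second_invariant L M hD h2 hL hα0 hα hβ0 hβ''0 (Kf - k) k (by omega) μ ν ρ i
    refine h.trans (div_le_div_of_nonneg_right ?_ (by positivity))
    have hL1 : 1 ≤ L := le_trans (by norm_num) hL
    have hKk := cast_lev_mono L hL1 hk.le
    have hD0 : 0 ≤ (((lev L k : ℕ) : ℝ))⁻¹ - (((lev L Kf : ℕ) : ℝ))⁻¹ := sub_nonneg.2 (inv_anti₀ hℓ0 hKk)
    have hD1 : (((lev L k : ℕ) : ℝ))⁻¹ - (((lev L Kf : ℕ) : ℝ))⁻¹ ≤ 1 := by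
      have : (((lev L k : ℕ) : ℝ))⁻¹ ≤ 1 := inv_le_one_of_one_le₀ hℓ1
      have : 0 ≤ (((lev L Kf : ℕ) : ℝ))⁻¹ := by positivity
      linarith
    set Dk := (((lev L k : ℕ) : ℝ))⁻¹ - (((lev L Kf : ℕ) : ℝ))⁻¹
    have hx0 : 0 ≤ 4 * α' * Dk := by positivity
    have hx1 : 4 * α' * Dk ≤ 1 / 2 := by nlinarith
    have hsq : 4 * α' * Dk * (4 * α' * Dk) ≤ 4 * α' * Dk * (1 / 2) := mul_le_mul_of_nonneg_left hx1 hx0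
    have hE2 : Real.exp (4 * α' * Dk) ≤ 2 := by
      have h' := (le_abs_self _).trans (Real.abs_exp_sub_one_sub_id_le (x := 4 * α' * Dk)
        (by rw [abs_of_nonneg hx0]; exact hx1.trans (by norm_num)))
      nlinarith [hsq]
    have hB : β'' + 16 * β' ^ 2 * Dk ≤ β'' + 16 * β' ^ 2 := by nlinarith [sq_nonneg β']
    exact mul_le_mul hE2 hB (by positivity) (by norm_num)

omit hM in
/-- [folklore] **DISTANCE SHIFT, UNIFORM** (the `ρ₁` induction): `‖(R − S)_μ(τ_ν y) − (R − S)_μ(y)‖ ≤ 4(κ₁ + 9κ(2β′ + 16κ))∕ℓ_k³` at EVERY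
level (`α′ ≤ 1∕16`, `κ ≤ 1∕64`, `2 ≤ L`; above `Kf` the distance is `0`; step `B13ReadingsAvgTowerSecond.dist_shift_of_step` fed by the
k-uniform first-order letters — sizes `2α′ + 8κ`, plain Lipschitz `2β′ + 16κ`, distance `8κ` — and `corr_shift`). -/
theorem dist_shift_uniform (hL : 2 ≤ L) (hα0 : 0 ≤ α') (hα : α' ≤ 1 / 16) (hβ0 : 0 ≤ β') (hκ0 : 0 ≤ κ) (hκ : κ ≤ 1 / 64)
    (hκ₁0 : 0 ≤ κ₁) : ∀ (k : ℕ) (μ ν : Fin d) (y : idx L M k),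
      ‖(R k μ (tau (fine (lev L k) M) ν y) - S k μ (tau (fine (lev L k) M) ν y)) - (R k μ y - S k μ y)‖
        ≤ 4 * (κ₁ + 9 * κ * (2 * β' + 16 * κ)) / ((lev L k : ℕ) : ℝ) ^ 3 := by
  have hα8 : α' ≤ 1 / 8 := hα.trans (by norm_num)
  have hLr : (2 : ℝ) ≤ L := by exact_mod_cast hL
  have hL0 : (0 : ℝ) < L := by linarith
  set β₁ := 2 * β' + 16 * κ with hβ₁
  set X := κ₁ + 9 * κ * β₁ with hX
  have hβ₁0 : 0 ≤ β₁ := by positivity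
  have hX0 : 0 ≤ X := by positivity
  have hRT := regularTransporters_of_factorisation L M hD hL hα0 hα hβ0 hκ0 hκ
  have hST := regularTransporters_straight L M hD hL hα0 hα8 hβ0
  suffices h : ∀ m k, k + m = Kf → ∀ (μ ν : Fin d) (y : idx L M k),
      ‖(R k μ (tau (fine (lev L k) M) ν y) - S k μ (tau (fine (lev L k) M) ν y)) - (R k μ y - S k μ y)‖
        ≤ 4 * X / ((lev L k : ℕ) : ℝ) ^ 3 by
    intro k μ ν y
    rcases le_or_gt Kf k with hk | hk
    · rw [hD.fin_eq k hk, hD.fin_eq k hk, sub_self, sub_self, sub_self, norm_zero]; positivity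
    · exact h (Kf - k) k (by omega) μ ν y
  intro m
  induction m with
  | zero =>
    intro k hk μ ν y; rw [add_zero] at hk; subst hk
    rw [hD.fin_eq k le_rfl, hD.fin_eq k le_rfl, sub_self, sub_self, sub_self, norm_zero]; positivity
  | succ m ih =>
    intro k hk μ ν y
    have hkK : k < Kf := by omega
    have hℓ1 : (1 : ℝ) ≤ (lev L k : ℕ) := by exact_mod_cast one_le_lev' L k
    have hℓ0 : (0 : ℝ) < (lev L k : ℕ) := by linarith
    have hℓ'0 : (0 : ℝ) < ((L * lev L k : ℕ) : ℝ) := by exact_mod_cast one_le_lev' L (k + 1)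
    -- level-(k+1) letters
    have hRsize : ∀ y' : Tor (fine (L * lev L k) M) × Fin d, ‖((L * lev L k : ℕ) : ℂ) • (R (k + 1) μ y' - 1)‖ ≤ 2 * α' + 8 * κ :=
      fun y' => hRT.size (k + 1) μ y'
    have hSsize : ∀ y' : Tor (fine (L * lev L k) M) × Fin d, ‖((L * lev L k : ℕ) : ℂ) • (S (k + 1) μ y' - 1)‖ ≤ 2 * α' + 8 * κ :=
      fun y' => (straight_size_uniform L M hD hL hα0 hα8 (k + 1) μ y').trans (by linarith)
    have hRlip : ∀ (ν₁ : Fin d) (y' : Tor (fine (L * lev L k) M) × Fin d),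
        ‖R (k + 1) μ (tau (fine (L * lev L k) M) ν₁ y') - R (k + 1) μ y'‖ ≤ β₁ / ((L * lev L k : ℕ) : ℝ) / ((L * lev L k : ℕ) : ℝ) :=
      fun ν₁ y' => norm_R_tau_sub_le L M hRT k μ ν₁ y'
    have hSlip : ∀ (ν₁ : Fin d) (y' : Tor (fine (L * lev L k) M) × Fin d),
        ‖S (k + 1) μ (tau (fine (L * lev L k) M) ν₁ y') - S (k + 1) μ y'‖ ≤ β₁ / ((L * lev L k : ℕ) : ℝ) / ((L * lev L k : ℕ) : ℝ) := by
      intro ν₁ y'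
      refine (norm_R_tau_sub_le L M hST k μ ν₁ y').trans ?_
      exact div_le_div_of_nonneg_right (div_le_div_of_nonneg_right (by rw [hβ₁]; linarith) hℓ'0.le) hℓ'0.le
    have hdist : ∀ y' : Tor (fine (L * lev L k) M) × Fin d, ‖R (k + 1) μ y' - S (k + 1) μ y'‖ ≤ 8 * κ / ((L * lev L k : ℕ) : ℝ) ^ 2 :=
      fun y' => dist_uniform L M hD hL hα0 hα hκ0 hκ (k + 1) μ y'
    have hshift : ∀ (ν₁ : Fin d) (y' : Tor (fine (L * lev L k) M) × Fin d),
        ‖(R (k + 1) μ (tau (fine (L * lev L k) M) ν₁ y') - S (k + 1) μ (tau (fine (L * lev L k) M) ν₁ y'))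
            - (R (k + 1) μ y' - S (k + 1) μ y')‖ ≤ 4 * X / ((L * lev L k : ℕ) : ℝ) ^ 3 :=
      fun ν₁ y' => ih (k + 1) (by omega) μ ν₁ y'
    -- the two structures at `y` and `τ_ν y`
    have hR0 := hD.averaging k hkK μ y
    have hR1 : R k μ (tau (fine (lev L k) M) ν y) = Cf k μ (tau (fine (lev L k) M) ν y) * lprod (fun t => R (k + 1) μ
        (st k μ y + tstep (fine (L * lev L k) M) ν L + tstep (fine (L * lev L k) M) μ t, y.2)) L := by
      have h := hD.averaging k hkK μ (tau (fine (lev L k) M) ν y); rw [hD.start_shift] at h; exact h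
    have hS0 := hD.straight k hkK μ y
    have hS1 : S k μ (tau (fine (lev L k) M) ν y) = lprod (fun t => S (k + 1) μ
        (st k μ y + tstep (fine (L * lev L k) M) ν L + tstep (fine (L * lev L k) M) μ t, y.2)) L := by
      have h := hD.straight k hkK μ (tau (fine (lev L k) M) ν y); rw [hD.start_shift] at h; exact h
    have hstep := dist_shift_of_step L M (k := k) (μ := μ) (ν := ν) (i := y) hRsize hSsize hRlip hSlip hdist hshift hR0 hR1 hS0 hS1
      (hD.corr k hkK μ y) (h2.corr_shift k hkK μ ν y)
    refine hstep.trans ?_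
    -- arithmetic: `e^{α∕ℓ}(κ₁∕ℓ³ + κβ₁∕ℓ⁴ + 16κβ₁∕(Lℓ⁴) + 4X∕(Lℓ³)) ≤ (4∕3)·3X∕ℓ³`
    have hx0 : 0 ≤ (2 * α' + 8 * κ) / ((lev L k : ℕ) : ℝ) := by positivity
    have hx1 : (2 * α' + 8 * κ) / ((lev L k : ℕ) : ℝ) ≤ 1 / 4 := (div_le_self (by positivity) hℓ1).trans (by linarith)
    have hexp : Real.exp ((2 * α' + 8 * κ) / ((lev L k : ℕ) : ℝ)) ≤ 4 / 3 := exp_le_four_thirds hx0 hx1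
    have hι : (((lev L k : ℕ) : ℝ))⁻¹ ≤ 1 := inv_le_one_of_one_le₀ hℓ1
    have hLi : (L : ℝ)⁻¹ ≤ 1 / 2 := by rw [one_div]; exact inv_anti₀ (by norm_num) hLr
    have hbr : κ₁ / ((lev L k : ℕ) : ℝ) ^ 3 + κ * β₁ / ((lev L k : ℕ) : ℝ) ^ 4 + 2 * β₁ * (8 * κ) / (L * ((lev L k : ℕ) : ℝ) ^ 4)
          + 4 * X / (L * ((lev L k : ℕ) : ℝ) ^ 3)
        = (κ₁ + κ * β₁ * (((lev L k : ℕ) : ℝ))⁻¹ + 16 * κ * β₁ * ((L : ℝ)⁻¹ * (((lev L k : ℕ) : ℝ))⁻¹) + 4 * X * (L : ℝ)⁻¹)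
          / ((lev L k : ℕ) : ℝ) ^ 3 := by
      field_simp; ring
    rw [hbr, ← mul_div_assoc]
    refine div_le_div_of_nonneg_right ?_ (by positivity)
    have h1 : κ * β₁ * (((lev L k : ℕ) : ℝ))⁻¹ ≤ κ * β₁ := mul_le_of_le_one_right (by positivity) hι
    have h2' : 16 * κ * β₁ * ((L : ℝ)⁻¹ * (((lev L k : ℕ) : ℝ))⁻¹) ≤ 16 * κ * β₁ * (1 / 2) := by
      refine mul_le_mul_of_nonneg_left ?_ (by positivity)
      calc (L : ℝ)⁻¹ * (((lev L k : ℕ) : ℝ))⁻¹ ≤ (L : ℝ)⁻¹ * 1 := mul_le_mul_of_nonneg_left hι (by positivity)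
        _ ≤ 1 / 2 := by rw [mul_one]; exact hLi
    have h3 : 4 * X * (L : ℝ)⁻¹ ≤ 4 * X * (1 / 2) := mul_le_mul_of_nonneg_left hLi (by positivity)
    have hin : κ₁ + κ * β₁ * (((lev L k : ℕ) : ℝ))⁻¹ + 16 * κ * β₁ * ((L : ℝ)⁻¹ * (((lev L k : ℕ) : ℝ))⁻¹) + 4 * X * (L : ℝ)⁻¹
        ≤ 3 * X := by
      rw [hX] at h3 ⊢; linarith
    calc Real.exp ((2 * α' + 8 * κ) / ((lev L k : ℕ) : ℝ))
          * (κ₁ + κ * β₁ * (((lev L k : ℕ) : ℝ))⁻¹ + 16 * κ * β₁ * ((L : ℝ)⁻¹ * (((lev L k : ℕ) : ℝ))⁻¹) + 4 * X * (L : ℝ)⁻¹)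
        ≤ (4 / 3) * (3 * X) := mul_le_mul hexp hin (by positivity) (by norm_num)
      _ = 4 * X := by ring

omit hM in
/-- [folklore] **END — (ℓ2) `hlipD` AT EVERY LEVEL, k-UNIFORM** (the `hlipD` binder of `NE2FromNE3BavgBridge.localRate_regClass_of_bavg_consistent`
for the averaging tower `R`, token for token): `‖dconnTower R k μ (τ_ν i) − dconnTower R k μ i‖ ≤ βD∕lev L k` with
`βD = 2(β″ + 16β′²) + 8(κ₁ + 9κ(2β′ + 16κ))` — `B13ReadingsAvgTowerSecond.hlipD_of_second_letters` fed by `straight_second_uniform` and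
`dist_shift_uniform` (`α′ ≤ 1∕16`, `κ ≤ 1∕64`, `2 ≤ L`, `0 ≤ β′, β″, κ, κ₁`). -/
theorem hlipD_of_factorisation (hL : 2 ≤ L) (hα0 : 0 ≤ α') (hα : α' ≤ 1 / 16) (hβ0 : 0 ≤ β') (hβ''0 : 0 ≤ β'') (hκ0 : 0 ≤ κ)
    (hκ : κ ≤ 1 / 64) (hκ₁0 : 0 ≤ κ₁) (k : ℕ) (μ ν : Fin d) (i : idx L M k) :
    ‖dconnTower L M R k μ (tau (fine (lev L k) M) ν i) - dconnTower L M R k μ i‖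
      ≤ (2 * (β'' + 16 * β' ^ 2) + 8 * (κ₁ + 9 * κ * (2 * β' + 16 * κ))) / (lev L k : ℕ) := by
  have hα8 : α' ≤ 1 / 8 := hα.trans (by norm_num)
  have h := hlipD_of_second_letters L M (R := R) (S := S) (k := k) (b₂ := 2 * (β'' + 16 * β' ^ 2))
    (ρ₁ := 4 * (κ₁ + 9 * κ * (2 * β' + 16 * κ)))
    (fun μ ν ν' x c => straight_second_uniform L M hD h2 hL hα0 hα8 hβ0 hβ''0 k μ ν ν' (x, c))
    (fun μ ν y => dist_shift_uniform L M hD h2 hL hα0 hα hβ0 hκ0 hκ hκ₁0 k μ ν y) μ ν i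
  refine h.trans (le_of_eq ?_)
  ring

omit hM in
/-- [folklore] … and for the STRAIGHT tower itself (distance `0`): `‖dconnTower S k μ (τ_ν i) − dconnTower S k μ i‖ ≤ 2(β″ + 16β′²)∕lev L k`
(`α′ ≤ 1∕8`, `2 ≤ L`). -/
theorem hlipD_straight (hL : 2 ≤ L) (hα0 : 0 ≤ α') (hα : α' ≤ 1 / 8) (hβ0 : 0 ≤ β') (hβ''0 : 0 ≤ β'')
    (k : ℕ) (μ ν : Fin d) (i : idx L M k) :
    ‖dconnTower L M S k μ (tau (fine (lev L k) M) ν i) - dconnTower L M S k μ i‖ ≤ 2 * (β'' + 16 * β' ^ 2) / (lev L k : ℕ) := by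
  have h := hlipD_of_second_letters L M (R := S) (S := S) (k := k) (b₂ := 2 * (β'' + 16 * β' ^ 2)) (ρ₁ := 0)
    (fun μ ν ν' x c => straight_second_uniform L M hD h2 hL hα0 hα hβ0 hβ''0 k μ ν ν' (x, c))
    (fun μ ν y => by rw [sub_self, sub_self, sub_self, norm_zero]; positivity) μ ν i
  rw [mul_zero, add_zero] at h
  exact h

end Induction

end Summit.QuantumFields.BalabanUV.T4Continuum.B13ReadingsAvgTowerSecondUniform

end
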